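import Summits.ValiantsHypothesis.ValiantsHypothesis.Theses.DetQP
import Summits.ValiantsHypothesis.ValiantsHypothesis.Theses.UlrichPadded
import Literature.Computability.AlgebraicComplexity.Hyperdeterminant
import Literature.Computability.AlgebraicComplexity.ValiantCompleteness
import Literature.Computability.AlgebraicComplexity.VNPClosedUnderProjection
import Literature.Computability.AlgebraicComplexity.DeterminantalComplexityProofs
import Literature.Computability.AlgebraicComplexity.StandardFamiliesProofs
import Literature.Computability.AlgebraicComplexity.ValiantClassesProofs
import Summits.ValiantsHypothesis.ValiantsHypothesis.Theorems.DetQPDetqpThesisStubIsVNPFamilyHyperdet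
import Summits.ValiantsHypothesis.ValiantsHypothesis.Theorems.DetQPDetqpThesisStubIsPProjectionHyperdetPerPoly
import Summits.ValiantsHypothesis.ValiantsHypothesis.Theorems.DetQPDetqpThesisStubDetqpThesisOfIsPProjection
import Summits.ValiantsHypothesis.ValiantsHypothesis.Theorems.DetQPDetqpThesisStubDcPerPolyLeDcHyperdet
import Literature.Computability.AlgebraicComplexity.MignonRessayreBound
import Summits.ValiantsHypothesis.ValiantsHypothesis.Theorems.DetQPDetqpThesisStubHess0HyperdetEqSum
import Summits.ValiantsHypothesis.ValiantsHypothesis.Theorems.DetQPDetqpThesisStubHdBlockEmbSumEq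
import Summits.ValiantsHypothesis.ValiantsHypothesis.Theorems.DetQPDetqpThesisStubHdPatternMulVecInjective

/-!
# Line `Sketch` (idea `four-dimensional-determinant`) — skeleton for crux `DetQP.DetqpThesis`
# (stmt-ValiantsHypothesis-0315; routes DetQP (decl `DetqpThesis`) and UlrichPadded (decl `Target`,
# the same term) — shared item)

Crux (by name): `Summit.ValiantsHypothesis.ValiantsHypothesis.Theses.DetQP.DetqpThesis` =
`¬ IsQPBounded (fun n => determinantalComplexity (perPoly (Fin n) ℂ))` — the Extended Valiant
Hypothesis over `ℂ` in dc form (Cruxes/DetqpThesis/Disproof.lean: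
`detqpThesis_iff_extendedValiantHypothesis`).

## The line (idea card `Cruxes/DetqpThesis/Ideas/four-dimensional-determinant.md`, triage r1: 2 × pass)

LEVER. Swap the permanent for Cayley's first (combinatorial) hyperdeterminant of format `n × n × n × n`.
In TREE vocabulary (no new definition): `HD_n := hyperdet (fun I : Fin 4 → Fin n => X I)`
(`Literature.Computability.AlgebraicComplexity.hyperdet`, Hyperdeterminant.lean — the sum over FOUR
permutations; the card's `CH_n`, first slot fixed, is `HD_n / n!` over `ℂ`).  Substituting
`x_I ↦ [I 2 = I 0] [I 3 = I 1] · X_{I 0, I 1}` gives `n! · per_n` (Gurvits 2004, Ex. 3.3), and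
`HD ∈ VNP`; with Valiant completeness of `per` (tree: `isVNPComplete_perPoly_holds`, `ringChar ℂ ≠ 2`)
the crux `X` is EQUIVALENT to `X_HD := ¬ IsQPBounded (fun n => dc (HD_n))`.

COMPOSITION (`DetqpThesis_of`, sorry-free apart from the stubs):
S2 `stub_isVNPFamily_hyperdet` (HD ∈ VNP) → S3 `stub_isPProjection_hyperdet_perPoly` (completeness
transfer: HD is a p-projection of per) → S4 `stub_detqpThesis_of_isPProjection` (qp ∘ poly = qp:
a p-projection of `per` with non-qp-bounded `dc` proves the crux) fed with S5 `stub_hyperdet_not_qp`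
(= `X_HD`, the load-bearing stub).  S6 `stub_dc_perPoly_le_dc_hyperdet` (`dc(per_n) ≤ dc(HD_n)`,
`n ≥ 1`) is the converse bookkeeping: with it `hyperdet_not_qp_iff_detqpThesis` records that S5 is
EXACTLY the crux (the transfer is an equivalence, triage r1-1), i.e. S5 is the Extended Valiant
Hypothesis for the VNP-complete family `HD`.

## Disproof.lean used (cdisprove v2, Cruxes/DetqpThesis/Disproof.lean @a2447a268549)

No `_false_without_` theorem exists (the crux has no hypothesis).  Used: (F) the crux is `PER ∉ VQP`
= EVH over `ℂ` — so S5 for a VNP-complete proxy is crux-equivalent by design, recorded here as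
`hyperdet_not_qp_iff_detqpThesis`; (A) `char ≠ 2` is load-bearing — consumed inside S3 through
`isVNPComplete_perPoly_holds ℂ (ringChar ℂ ≠ 2)`; (E') `qpBound_comp_le` (qp ∘ poly) is the shape of
S4; the landed negative lemmas `Theorems/DetqpThesis/Negative/*` are not needed by the composition.
-/

noncomputable section

-- `Summit.ValiantsHypothesis.ValiantsHypothesis.…` is the tree's mandated single-conjunct layout.
set_option linter.dupNamespace false

namespace Summit.ValiantsHypothesis.ValiantsHypothesis.Cruxes.DetqpThesis.FourDimensionalDeterminant

open Literature.Computability.AlgebraicComplexity MvPolynomial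

/-! ## Stubs (registered; each is proved as stated by one worker or by the lead) -/

/-- S2 — **`HD ∈ VNP` over `ℂ`**: the generic four-dimensional hyperdeterminant family
`HD_n = ∑_{σ₀,σ₁,σ₂,σ₃ ∈ 𝔖_n} (∏ sgn σ_j) ∏_i x_{σ₀ i, σ₁ i, σ₂ i, σ₃ i}` is p-definable: `n⁴`
variables, degree `n`, Boolean sum over four `n × n` position matrices recognised by BCS's `α · β`
(HamiltonianCycleVNP.lean technique), signs as determinants of the position matrices. -/
theorem stub_isVNPFamily_hyperdet :
    IsVNPFamily (fun n => hyperdet (fun I : Fin 4 → Fin n => (X I : MvPolynomial (Fin 4 → Fin n) ℂ))) :=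
  -- LANDED (wave 1, p87809): Theorems/DetQPDetqpThesisStubIsVNPFamilyHyperdet.lean
  Summit.ValiantsHypothesis.ValiantsHypothesis.Theorems.DetQPDetqpThesis.stub_isVNPFamily_hyperdet

/-- S3 — **completeness transfer**: a `VNP` family is a p-projection of the permanent over `ℂ`
(`isVNPComplete_perPoly_holds`, `ringChar ℂ = 0 ≠ 2`), after renaming the variables `Fin 4 → Fin n`
to `Fin (n⁴)` (`isVNPFamily_renameEquiv_iff`) and back (a renaming is a projection). -/
theorem stub_isPProjection_hyperdet_perPoly
    (h : IsVNPFamily (fun n => hyperdet (fun I : Fin 4 → Fin n => (X I : MvPolynomial (Fin 4 → Fin n) ℂ)))) :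
    IsPProjection (fun n => hyperdet (fun I : Fin 4 → Fin n => (X I : MvPolynomial (Fin 4 → Fin n) ℂ)))
      (fun n => perPoly (Fin n) ℂ) :=
  -- LANDED (wave 1, p86017): Theorems/DetQPDetqpThesisStubIsPProjectionHyperdetPerPoly.lean
  Summit.ValiantsHypothesis.ValiantsHypothesis.Theorems.DetQPDetqpThesis.stub_isPProjection_hyperdet_perPoly h

/-- S4 — **qp ∘ poly = qp glue**: if `g` is a p-projection of the permanent family and `dc ∘ g` is
not quasi-polynomially bounded, then neither is `dc ∘ per`, i.e. the crux holds
(`determinantalComplexity_le_of_isProjection_holds` + the template arithmetic of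
Disproof.lean `qpBound_comp_le`). -/
theorem stub_detqpThesis_of_isPProjection (σ : ℕ → Type) (g : ∀ n, MvPolynomial (σ n) ℂ)
    (hg : IsPProjection g (fun n => perPoly (Fin n) ℂ))
    (hX : ¬ IsQPBounded (fun n => determinantalComplexity (g n))) :
    Summit.ValiantsHypothesis.ValiantsHypothesis.Theses.DetQP.DetqpThesis :=
  -- LANDED (wave 1, p86466): Theorems/DetQPDetqpThesisStubDetqpThesisOfIsPProjection.lean
  Summit.ValiantsHypothesis.ValiantsHypothesis.Theorems.DetQPDetqpThesis.stub_detqpThesis_of_isPProjection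
    σ g hg hX

/-- S5 — **THE load-bearing stub `X_HD`**: the determinantal complexity of the generic
four-dimensional hyperdeterminant is not quasi-polynomially bounded.  Crux-equivalent
(`hyperdet_not_qp_iff_detqpThesis`): it is the Extended Valiant Hypothesis for a `VNP`-complete
family.  Held by the lead. -/
theorem stub_hyperdet_not_qp :
    ¬ IsQPBounded (fun n => determinantalComplexity
      (hyperdet (fun I : Fin 4 → Fin n => (X I : MvPolynomial (Fin 4 → Fin n) ℂ)))) := by
  sorry

/-- S6 — **converse bookkeeping** `dc(per_n) ≤ dc(HD_n)` for `n ≥ 1`: the substitution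
`x_I ↦ [I 2 = I 0][I 3 = I 1] X_{I 0, I 1}` turns `HD_n` into `n! · per_n` (Gurvits 2004, Ex. 3.3), a
projection (`determinantalComplexity_le_of_isProjection_holds`), and a unit scalar does not change
`dc` once `dc ≥ 1` (scale one row). -/
theorem stub_dc_perPoly_le_dc_hyperdet (n : ℕ) (hn : 1 ≤ n) :
    determinantalComplexity (perPoly (Fin n) ℂ) ≤
      determinantalComplexity (hyperdet (fun I : Fin 4 → Fin n => (X I : MvPolynomial (Fin 4 → Fin n) ℂ))) :=
  -- LANDED (wave 1, p87049): Theorems/DetQPDetqpThesisStubDcPerPolyLeDcHyperdet.lean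
  Summit.ValiantsHypothesis.ValiantsHypothesis.Theorems.DetQPDetqpThesis.stub_dc_perPoly_le_dc_hyperdet n hn

/-! ## Composition: the line concludes the crux BY NAME (modulo the stubs) -/

/-- **The line concludes the crux** `DetQP.DetqpThesis`: S2 → S3 → S4 ← S5. -/
theorem DetqpThesis_of :
    Summit.ValiantsHypothesis.ValiantsHypothesis.Theses.DetQP.DetqpThesis :=
  stub_detqpThesis_of_isPProjection (fun n => Fin 4 → Fin n)
    (fun n => hyperdet (fun I : Fin 4 → Fin n => (X I : MvPolynomial (Fin 4 → Fin n) ℂ)))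
    (stub_isPProjection_hyperdet_perPoly stub_isVNPFamily_hyperdet) stub_hyperdet_not_qp

/-- The shared item's other name, BY NAME: route UlrichPadded's `Target` (payload route_id) is the
same term. -/
theorem Target_of :
    Summit.ValiantsHypothesis.ValiantsHypothesis.Theses.UlrichPadded.Target :=
  DetqpThesis_of

/-! ## The transfer is an equivalence: S5 is exactly the crux -/

/-- `X → X_HD`: if `dc ∘ HD` were qp-bounded then so would be `dc ∘ per` (S6 for `n ≥ 1`;
`dc(per_0) = dc(1) = 0` at `n = 0`). -/
theorem hyperdet_not_qp_of_detqpThesis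
    (hX : Summit.ValiantsHypothesis.ValiantsHypothesis.Theses.DetQP.DetqpThesis) :
    ¬ IsQPBounded (fun n => determinantalComplexity
      (hyperdet (fun I : Fin 4 → Fin n => (X I : MvPolynomial (Fin 4 → Fin n) ℂ)))) := by
  rintro ⟨c, hc⟩
  refine hX ⟨c, fun n => ?_⟩
  rcases Nat.eq_zero_or_pos n with rfl | hn
  · -- `per_0 = 1` has the empty determinantal representation
    have h1 : perPoly (Fin 0) ℂ = 1 := by
      simp [perPoly, Matrix.permanent]
    have h0 : determinantalComplexity (perPoly (Fin 0) ℂ) = 0 := by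
      rw [h1]
      exact Nat.eq_zero_of_le_zero
        (determinantalComplexity_le_of_hasDetRepr ⟨0, fun i => i.elim0, Matrix.det_isEmpty⟩)
    simp [h0]
  · exact (stub_dc_perPoly_le_dc_hyperdet n hn).trans (hc n)

/-- **S5 ⟺ crux.**  The load-bearing stub of this line is literally equivalent to `DetqpThesis`
(hence to the Extended Valiant Hypothesis over `ℂ`): the line relocates the crux to a
`VNP`-complete family with connected stabiliser `SL_n⁴`; it does not shrink it. -/
theorem hyperdet_not_qp_iff_detqpThesis :
    (¬ IsQPBounded (fun n => determinantalComplexity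
      (hyperdet (fun I : Fin 4 → Fin n => (X I : MvPolynomial (Fin 4 → Fin n) ℂ))))) ↔
    Summit.ValiantsHypothesis.ValiantsHypothesis.Theses.DetQP.DetqpThesis :=
  ⟨fun h => stub_detqpThesis_of_isPProjection (fun n => Fin 4 → Fin n)
      (fun n => hyperdet (fun I : Fin 4 → Fin n => (X I : MvPolynomial (Fin 4 → Fin n) ℂ)))
      (stub_isPProjection_hyperdet_perPoly stub_isVNPFamily_hyperdet) h,
    hyperdet_not_qp_of_detqpThesis⟩

/-! ## Toward S5 — first milestone: the Mignon–Ressayre floor for `HD`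

S5 itself is crux-equivalent; the only honest progress a line lead can make on it inside this line
is the card's "first NON-bookkeeping lemma": the Hessian of `HD_n` is non-degenerate at a point of
`Z(HD_n)`, whence `dc(HD_n) ≥ n⁴ / 2` by Mignon–Ressayre's rank bound (`rank_hess0_det_le`, in
tree) — the `N/2` floor in the `N = n⁴` variables, i.e. `HD` behaves at second order exactly like
`per` and `det` (calibration kit j013681 had this numerically for `n ≤ 4` at random points).

The point is STRUCTURED: the diagonal block embedding `A₀` of the Mignon–Ressayre point `y₀`
(`HD(A₀) = n! · per(y₀) = 0`, `hyperdet_blockArr` + `eval_mrPoint_perPoly`).  Two stubs: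
T1 = T1a `stub_hess0_hyperdet_eq_sum` + T1b `stub_hdBlockEmb_sum_eq` — the COVARIANCE IDENTITY (any `n`, any matrix point `Y`):
`Hess(HD_n)(blockEmb Y)[I,J] = n! · ε(I,J) · Hess(per_n)(Y)[(I 0,I 1),(J 0,J 1)]` where `ε ∈ {0, ±1}`
tests that slots 2, 3 of `I, J` are "diagonal or swapped" (verified by exact computer algebra for
`n ≤ 4`, random `Y`; scratch/check_struct.py); T2 `stub_hdPattern_mulVec_injective` — the resulting
pattern matrix `ε(I,J) · mrHess (I 0,I 1) (J 0,J 1)` has trivial kernel in characteristic 0 (block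
triangular over the four diagonal/off-diagonal types; the diagonal-diagonal block is `mrHess`
itself, `mrHess_mulVec_injective` in tree; exact rank `n⁴` checked for `n = 3, 4`,
scratch/check_E.py).  Assembly `pow_four_le_two_mul_determinantalComplexity_hyperdet` below is
sorry-free modulo T1, T2. -/

/-- T1a — **the Hessian of `HD_n` at an arbitrary point**, as an explicit finite sum: the second
partial `∂_I ∂_J` of the monomial `∏_i x_{σ₀ i, σ₁ i, σ₂ i, σ₃ i}` (distinct variables, `σ₀` being a
permutation) is the sum over ordered pairs of positions `p ≠ q` carrying `x_I` and `x_J` of the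
product of the remaining `n - 2` variables (Leibniz; cf. `pderiv_pderiv_prod_X_perm` for the
permanent), evaluated at `x` (`hess0_transl`). -/
theorem stub_hess0_hyperdet_eq_sum (n : ℕ) (x : (Fin 4 → Fin n) → ℂ) (I J : Fin 4 → Fin n) :
    hess0 (transl x (hyperdet (fun I : Fin 4 → Fin n => (X I : MvPolynomial (Fin 4 → Fin n) ℂ)))) I J =
    ∑ σ : Fin 4 → Equiv.Perm (Fin n), (∏ j, (Equiv.Perm.sign (σ j) : ℂ)) *
      ∑ p : Fin n, ∑ q : Fin n,
        if p ≠ q ∧ (fun j => σ j p) = I ∧ (fun j => σ j q) = J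
        then ∏ i ∈ (Finset.univ.erase p).erase q, x (fun j => σ j i) else 0 :=
  -- LANDED (wave 2, p89214): Theorems/DetQPDetqpThesisStubHess0HyperdetEqSum.lean
  Summit.ValiantsHypothesis.ValiantsHypothesis.Theorems.DetQPDetqpThesis.stub_hess0_hyperdet_eq_sum n x I J

/-- T1b — **the combinatorial heart of the covariance identity**: at the diagonal block embedding
`blockEmb Y : K ↦ [K 2 = K 0][K 3 = K 1] Y (K 0, K 1)` of a matrix point `Y`, the sum of T1a
collapses to `n!` times `ε(I, J)` times the Hessian entry `((I 0, I 1), (J 0, J 1))` of `per_n` at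
`Y` (`hess0_transl_perPoly`: the `(n-2)`-sub-permanent sum), where `ε(I,J) = ε₂ ε₃`, `ε₂ = +1` if
`I 2 = I 0 ∧ J 2 = J 0`, `ε₂ = -1` if `I 2 = J 0 ∧ J 2 = I 0`, `ε₂ = 0` otherwise, and likewise
`ε₃` on slots `3 / 1`.  (A term `(σ, p, q)` survives iff all factors off `{p, q}` are diagonal,
i.e. `σ₂ = σ₀`, `σ₃ = σ₁` off `{p, q}`; bijectivity of `σ₂, σ₃` then forces the
diagonal-or-swapped pattern at `{p, q}` with `sgn σ₂ = ε₂ sgn σ₀`, `sgn σ₃ = ε₃ sgn σ₁`; the map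
`(p, q, σ₀, σ₁) ↦ (σ₁, π := σ₀ σ₁⁻¹)` is a bijection onto `𝔖_n × {π : π (I 1) = I 0, π (J 1) = J 0}`
with `p = σ₁⁻¹ (I 1)`, `q = σ₁⁻¹ (J 1)`, and `∏_{i ∉ {p,q}} Y (σ₀ i, σ₁ i) = ∏_{c ∉ {I 1, J 1}} Y (π c, c)`.)
Verified by exact computer algebra for `n ≤ 4` and random integer `Y` (scratch/check_struct.py). -/
theorem stub_hdBlockEmb_sum_eq (n : ℕ) (Y : Fin n × Fin n → ℂ) (I J : Fin 4 → Fin n) :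
    (∑ σ : Fin 4 → Equiv.Perm (Fin n), (∏ j, (Equiv.Perm.sign (σ j) : ℂ)) *
      ∑ p : Fin n, ∑ q : Fin n,
        if p ≠ q ∧ (fun j => σ j p) = I ∧ (fun j => σ j q) = J
        then ∏ i ∈ (Finset.univ.erase p).erase q,
          (fun K : Fin 4 → Fin n => if K 2 = K 0 ∧ K 3 = K 1 then Y (K 0, K 1) else 0) (fun j => σ j i)
        else 0) =
    (n.factorial : ℂ) *
      (if ((I 2 = I 0 ∧ J 2 = J 0) ∨ (I 2 = J 0 ∧ J 2 = I 0)) ∧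
          ((I 3 = I 1 ∧ J 3 = J 1) ∨ (I 3 = J 1 ∧ J 3 = I 1))
        then (if I 2 = I 0 then 1 else -1) * (if I 3 = I 1 then 1 else -1) else 0) *
      hess0 (transl Y (perPoly (Fin n) ℂ)) (I 0, I 1) (J 0, J 1) :=
  -- LANDED (wave 2, p89516): Theorems/DetQPDetqpThesisStubHdBlockEmbSumEq.lean
  Summit.ValiantsHypothesis.ValiantsHypothesis.Theorems.DetQPDetqpThesis.stub_hdBlockEmb_sum_eq n Y I J

/-- T1 (= T1a + T1b) — **covariance of the Hessian under the diagonal block embedding** (any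
`n`, any point `Y` of matrix space): the Hessian of `HD_n` at `blockEmb Y` has entry `(I, J)`
equal to `n! · ε(I, J) · Hess(per_n)(Y)[(I 0, I 1), (J 0, J 1)]`. -/
theorem hess0_hyperdet_blockEmb (n : ℕ) (Y : Fin n × Fin n → ℂ) (I J : Fin 4 → Fin n) :
    hess0 (transl (fun K : Fin 4 → Fin n => if K 2 = K 0 ∧ K 3 = K 1 then Y (K 0, K 1) else 0)
      (hyperdet (fun I : Fin 4 → Fin n => (X I : MvPolynomial (Fin 4 → Fin n) ℂ)))) I J =
    (n.factorial : ℂ) *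
      (if ((I 2 = I 0 ∧ J 2 = J 0) ∨ (I 2 = J 0 ∧ J 2 = I 0)) ∧
          ((I 3 = I 1 ∧ J 3 = J 1) ∨ (I 3 = J 1 ∧ J 3 = I 1))
        then (if I 2 = I 0 then 1 else -1) * (if I 3 = I 1 then 1 else -1) else 0) *
      hess0 (transl Y (perPoly (Fin n) ℂ)) (I 0, I 1) (J 0, J 1) := by
  rw [stub_hess0_hyperdet_eq_sum, stub_hdBlockEmb_sum_eq]

/-- T2 — **the hyperdeterminantal Hessian pattern is non-degenerate** (characteristic `0`): the
matrix `P[I,J] = ε(I,J) · mrHess (I 0, I 1) (J 0, J 1)` on `Fin 4 → Fin (m+3)` has injective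
`mulVec`.  (Proof: split a kernel vector `v` by the type of its index — slots 2, 3 diagonal or
not.  Rows of off/off type `I` see only `J = (I 2, I 3, I 0, I 1)` with coefficient
`mrHess ≠ 0`; rows of diag/off type with fixed columns `(b, d) = (I 1, I 3)` give the `n × n`
system `∑_{a' ≠ a} mrHess((a,b),(a',d)) w_{a'} = 0`, invertible (`(m+1)(J - 1)` or the bordered
`-2(J-1)` matrix); off/diag symmetric; rows of diag/diag type are `mrHess · w = 0`, and
`mrHess_mulVec_injective`.) -/
theorem stub_hdPattern_mulVec_injective (m : ℕ) :
    Function.Injective (Matrix.of fun I J : Fin 4 → Fin (m + 3) =>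
      (if ((I 2 = I 0 ∧ J 2 = J 0) ∨ (I 2 = J 0 ∧ J 2 = I 0)) ∧
          ((I 3 = I 1 ∧ J 3 = J 1) ∨ (I 3 = J 1 ∧ J 3 = I 1))
        then (if I 2 = I 0 then (1 : ℂ) else -1) * (if I 3 = I 1 then 1 else -1) else 0) *
      mrHess ℂ m (I 0, I 1) (J 0, J 1)).mulVec :=
  -- LANDED (wave 2, p89469): Theorems/DetQPDetqpThesisStubHdPatternMulVecInjective.lean
  Summit.ValiantsHypothesis.ValiantsHypothesis.Theorems.DetQPDetqpThesis.stub_hdPattern_mulVec_injective m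

/-- The Hessian of `HD_{m+3}` at the block-embedded Mignon–Ressayre point is
`((m+3)! · m!) •` the pattern matrix of T2 (T1 at `Y = y₀` and `hess0_transl_mrPoint_perPoly`). -/
theorem hess0_hyperdet_blockEmb_mrPoint (m : ℕ) :
    hess0 (transl (fun K : Fin 4 → Fin (m + 3) =>
        if K 2 = K 0 ∧ K 3 = K 1 then mrPoint ℂ m (K 0, K 1) else 0)
      (hyperdet (fun I : Fin 4 → Fin (m + 3) => (X I : MvPolynomial (Fin 4 → Fin (m + 3)) ℂ)))) =
    (((m + 3).factorial * m.factorial : ℕ) : ℂ) • (Matrix.of fun I J : Fin 4 → Fin (m + 3) =>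
      (if ((I 2 = I 0 ∧ J 2 = J 0) ∨ (I 2 = J 0 ∧ J 2 = I 0)) ∧
          ((I 3 = I 1 ∧ J 3 = J 1) ∨ (I 3 = J 1 ∧ J 3 = I 1))
        then (if I 2 = I 0 then (1 : ℂ) else -1) * (if I 3 = I 1 then 1 else -1) else 0) *
      mrHess ℂ m (I 0, I 1) (J 0, J 1)) := by
  ext I J
  rw [hess0_hyperdet_blockEmb, hess0_transl_mrPoint_perPoly]
  simp only [Matrix.smul_apply, Matrix.of_apply, smul_eq_mul, Nat.cast_mul]
  ring

/-- Hence that Hessian has full rank `(m+3)⁴` (T2, `rank_smul_eq`). -/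
theorem rank_hess0_hyperdet_blockEmb_mrPoint (m : ℕ) :
    (hess0 (transl (fun K : Fin 4 → Fin (m + 3) =>
        if K 2 = K 0 ∧ K 3 = K 1 then mrPoint ℂ m (K 0, K 1) else 0)
      (hyperdet (fun I : Fin 4 → Fin (m + 3) =>
        (X I : MvPolynomial (Fin 4 → Fin (m + 3)) ℂ))))).rank = (m + 3) ^ 4 := by
  rw [hess0_hyperdet_blockEmb_mrPoint, rank_smul_eq]
  · rw [Matrix.rank_of_isUnit _
      (Matrix.mulVec_injective_iff_isUnit.mp (stub_hdPattern_mulVec_injective m)),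
      Fintype.card_fun, Fintype.card_fin, Fintype.card_fin]
  · exact_mod_cast Nat.mul_ne_zero (Nat.factorial_ne_zero _) (Nat.factorial_ne_zero _)

/-- `HD_{m+3}` vanishes at the block-embedded Mignon–Ressayre point:
`HD(A₀) = (m+3)! · per(y₀) = 0` (`hyperdet_blockArr`, `eval_mrPoint_perPoly`). -/
theorem eval_blockEmb_mrPoint_hyperdet (m : ℕ) :
    eval (fun K : Fin 4 → Fin (m + 3) => if K 2 = K 0 ∧ K 3 = K 1 then mrPoint ℂ m (K 0, K 1) else 0)
      (hyperdet (fun I : Fin 4 → Fin (m + 3) => (X I : MvPolynomial (Fin 4 → Fin (m + 3)) ℂ))) = 0 := by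
  rw [map_hyperdet]
  simp only [eval_X]
  have hM : (fun K : Fin 4 → Fin (m + 3) => if K 2 = K 0 ∧ K 3 = K 1 then mrPoint ℂ m (K 0, K 1) else 0)
      = fun K : Fin 4 → Fin (m + 3) => if K 2 = K 0 ∧ K 3 = K 1
          then (Matrix.of fun a b : Fin (m + 3) => mrPoint ℂ m (a, b)) (K 0) (K 1) else 0 := by
    simp only [Matrix.of_apply]
  rw [hM, Summit.ValiantsHypothesis.ValiantsHypothesis.Theorems.DetQPDetqpThesis.hyperdet_blockArr,
    ← eval_perPoly, eval_mrPoint_perPoly, mul_zero]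

/-- **Milestone (modulo T1, T2): the Mignon–Ressayre floor for the four-dimensional
hyperdeterminant**, core inequality: if `HD_{m+3} = det A` with `A` an `M × M` matrix of affine
linear forms over `ℂ`, then `(m+3)⁴ ≤ 2M`. -/
theorem pow_four_le_two_mul_of_hasDetRepr_hyperdet {m M : ℕ}
    (h : HasDetRepr (hyperdet (fun I : Fin 4 → Fin (m + 3) =>
      (X I : MvPolynomial (Fin 4 → Fin (m + 3)) ℂ))) M) : (m + 3) ^ 4 ≤ 2 * M := by
  obtain ⟨A, hA, hdet⟩ := h
  set x₀ : (Fin 4 → Fin (m + 3)) → ℂ := fun K =>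
    if K 2 = K 0 ∧ K 3 = K 1 then mrPoint ℂ m (K 0, K 1) else 0 with hx₀
  set A' : Matrix (Fin M) (Fin M) (MvPolynomial (Fin 4 → Fin (m + 3)) ℂ) :=
    (transl x₀).mapMatrix A with hA'
  have hA'deg : ∀ i j, (A' i j).totalDegree ≤ 1 := fun i j =>
    (totalDegree_transl_le _ _).trans (hA i j)
  have hA'det : A'.det = transl x₀ (hyperdet (fun I : Fin 4 → Fin (m + 3) =>
      (X I : MvPolynomial (Fin 4 → Fin (m + 3)) ℂ))) := by
    rw [hA', ← AlgHom.map_det, hdet]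
  have h0 : constantCoeff A'.det = 0 := by
    rw [hA'det, constantCoeff_transl, hx₀, eval_blockEmb_mrPoint_hyperdet]
  have hrank := rank_hess0_det_le A' hA'deg h0
  rwa [hA'det, hx₀, rank_hess0_hyperdet_blockEmb_mrPoint] at hrank

/-- **Milestone (modulo T1, T2): `n⁴ ≤ 2 · dc(HD_n)` for `n ≥ 3`** — the determinantal complexity of
the generic four-dimensional hyperdeterminant is at least half its number of variables (the
infimum `dc` is attained, `hasDetRepr_determinantalComplexity_holds`). -/
theorem pow_four_le_two_mul_determinantalComplexity_hyperdet {n : ℕ} (hn : 3 ≤ n) :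
    n ^ 4 ≤ 2 * determinantalComplexity
      (hyperdet (fun I : Fin 4 → Fin n => (X I : MvPolynomial (Fin 4 → Fin n) ℂ))) := by
  obtain ⟨m, rfl⟩ : ∃ m, n = m + 3 := ⟨n - 3, by omega⟩
  exact pow_four_le_two_mul_of_hasDetRepr_hyperdet (hasDetRepr_determinantalComplexity_holds _)

end Summit.ValiantsHypothesis.ValiantsHypothesis.Cruxes.DetqpThesis.FourDimensionalDeterminant

end
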